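import Summits.QuantumFields.YangMills.Theorems.ForcedResponseSkewnessResponseLocalisationSignedSmear
import Summits.QuantumFields.YangMills.Theorems.ForcedResponseSkewnessResponseLocalisationSignedToolkit
import Summits.QuantumFields.YangMills.Theorems.ForcedResponseSkewnessResponseLocalisationSmearedDefs
import Summits.QuantumFields.YangMills.Theorems.ForcedResponseSkewnessFemtoOfFBL6
import HarnessLib

/-!
# Route `ForcedResponseSkewness`, crux `ResponseLocalisation` (stmt-QuantumFields-24869), line «signed-femto-collar» (line of record,
# lead ym-line-frs-p1 g4, 2026-08-28): registered analysis stub `stub_symContactOfFemto : SymContactOfFemtoSigR`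
# (`FBLPinnedSigR → SymNearCovLawSigR → SymContactKernelSigR`, Defs p613181)

Helper file (`--supports stmt-QuantumFields-24869`, seat `ym-line-frs-p2` g6): the lead's collar transfer `contactKernel_of_femto`
(p606368) with the radial weight carried INSIDE the near observable `W_φ = Σ_w φ(a‖w‖)(dens (z+w) − m_{z+w})(dens z − m_z)`
(`Signed.sum_torusK3_eq_integral_centred`); its kernel mean is exterior-uniformly within `κ'/M⁴ + #ball·64C₁²/M⁸` of `Σ_w φ n_β(w)`
(signed near-pair law on the `R`-ball + FBL twice), and `Femto.abs_integral_two_sub_mean_le` gives `|Σ_x φ κ₃| ≤ κ·a(β)⁸`.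
Statement texts: `Theorems/ForcedResponseSkewnessResponseLocalisationSmearedDefs.lean` (lead's append p613181: `SymNearCovLaw` with the
depth decoupled from the cut — `∀ κ ∀ d₀ ∃ R ≤ d₀ …`, here invoked with `d₀ = s/4`; `SymContactKernelSigR` = the design text verbatim).
Honest label: analysis on a conditional rung line (leaf R2a `BalabanLadder.NT`); `SymNearCovLawSigR` is an AF-class femto law, NOT proved;
NT and the YM mass gap are NOT proved by this.
-/

set_option autoImplicit false

noncomputable section

namespace Summit.QuantumFields.YangMills.Cruxes.ResponseLocalisation.Signed

open MeasureTheory Filter Topology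
open Literature.MathematicalPhysics.QuantumFieldTheory Literature.Probability.LatticeModels
open Literature.MathematicalPhysics.QuantumLattice hiding cubeEdges cubeSites
open Summit.QuantumFields.YangMills.Cruxes.OSLegsFromFemtoAndGap.DlrCollarTransfer
open Summit.QuantumFields.YangMills.Cruxes.RunningCouplingCeiling.Pointwise (torusDist)
open Summit.QuantumFields.YangMills.Cruxes.ResponseLocalisation.Birth
open Summit.QuantumFields.YangMills.Cruxes.ResponseLocalisation.Femto

/-! ## §1 Bookkeeping (pure real arithmetic, kept out of the main proof's heartbeat budget) -/

/-- Bookkeeping of the collar transfer `stub_symContactOfFemto`: with `ε₁ = C/M⁴`, `ε₂ = κ s⁸/(2048·C·M⁴) + N·64C²/M⁸`,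
`s ≤ 2Mt`, `N ≤ (2Rf/t + 1)⁴`, `t < Rf ≤ 1` and `Rf ≤ κ s¹²/(2²¹·81·C³)`, the product `4 ε₁ ε₂` is at most `κ t⁸`. [folklore] -/
theorem four_mul_eps_mul_eps_le {κ s t M C Rf N : ℝ} (hκ : 0 < κ) (hs0 : 0 < s) (ht0 : 0 < t) (hMpos : 0 < M)
    (hC : 0 < C) (hM2t : s ≤ 2 * M * t) (hN : N ≤ (2 * (Rf / t) + 1) ^ 4) (hN0 : 0 ≤ N) (htR : t < Rf)
    (hRf0 : 0 < Rf) (hRf1 : Rf ≤ 1) (hRfκ : Rf ≤ κ * s ^ 12 / (2 ^ 21 * 81 * C ^ 3)) :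
    4 * (C / M ^ 4) * (κ * s ^ 8 / (2048 * C) / M ^ 4 + N * (64 * C ^ 2 / M ^ 8)) ≤ κ * t ^ 8 := by
  have hMinv : 1 / M ≤ 2 * t / s := by rw [div_le_div_iff₀ hMpos hs0]; linarith only [hM2t]
  have hT1 : 4 * (C / M ^ 4) * (κ * s ^ 8 / (2048 * C) / M ^ 4) ≤ κ * t ^ 8 / 2 := by
    rw [show 4 * (C / M ^ 4) * (κ * s ^ 8 / (2048 * C) / M ^ 4) = (κ * s ^ 8 / 512) * (1 / M) ^ 8 by
      field_simp; ring]
    have h8 : (1 / M) ^ 8 ≤ (2 * t / s) ^ 8 := pow_le_pow_left₀ (by positivity) hMinv 8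
    calc κ * s ^ 8 / 512 * (1 / M) ^ 8 ≤ κ * s ^ 8 / 512 * (2 * t / s) ^ 8 :=
          mul_le_mul_of_nonneg_left h8 (by positivity)
      _ = κ * t ^ 8 / 2 := by field_simp; ring
  have hT2 : 4 * (C / M ^ 4) * (N * (64 * C ^ 2 / M ^ 8)) ≤ κ * t ^ 8 / 2 := by
    rw [show 4 * (C / M ^ 4) * (N * (64 * C ^ 2 / M ^ 8)) = N * (256 * C ^ 3 * (1 / M) ^ 12) by ring]
    have h12 : (1 / M) ^ 12 ≤ (2 * t / s) ^ 12 := pow_le_pow_left₀ (by positivity) hMinv 12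
    have hc4 : N * t ^ 4 ≤ (3 * Rf) ^ 4 := by
      calc N * t ^ 4 ≤ (2 * (Rf / t) + 1) ^ 4 * t ^ 4 := mul_le_mul_of_nonneg_right hN (by positivity)
        _ = (2 * Rf + t) ^ 4 := by rw [← mul_pow]; congr 1; field_simp
        _ ≤ (3 * Rf) ^ 4 := pow_le_pow_left₀ (by positivity) (by linarith only [htR]) 4
    have hRf4 : Rf ^ 4 ≤ Rf := pow_le_of_le_one hRf0.le hRf1 (by norm_num)
    have hRfκ' : 2 ^ 21 * 81 * C ^ 3 * Rf ≤ κ * s ^ 12 := by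
      have := (le_div_iff₀ (by positivity : (0 : ℝ) < 2 ^ 21 * 81 * C ^ 3)).1 hRfκ; linarith only [this]
    calc N * (256 * C ^ 3 * (1 / M) ^ 12)
        ≤ N * (256 * C ^ 3 * (2 * t / s) ^ 12) :=
          mul_le_mul_of_nonneg_left (mul_le_mul_of_nonneg_left h12 (by positivity)) hN0
      _ = (N * t ^ 4) * (2 ^ 20 * C ^ 3 * t ^ 8 / s ^ 12) := by ring
      _ ≤ (3 * Rf) ^ 4 * (2 ^ 20 * C ^ 3 * t ^ 8 / s ^ 12) := mul_le_mul_of_nonneg_right hc4 (by positivity)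
      _ = 81 * Rf ^ 4 * (2 ^ 20 * C ^ 3 * t ^ 8 / s ^ 12) := by ring
      _ ≤ 81 * Rf * (2 ^ 20 * C ^ 3 * t ^ 8 / s ^ 12) :=
          mul_le_mul_of_nonneg_right (by linarith only [hRf4]) (by positivity)
      _ = (2 ^ 21 * 81 * C ^ 3 * Rf) * (t ^ 8 / (2 * s ^ 12)) := by ring
      _ ≤ (κ * s ^ 12) * (t ^ 8 / (2 * s ^ 12)) := mul_le_mul_of_nonneg_right hRfκ' (by positivity)
      _ = κ * t ^ 8 / 2 := by field_simp
  rw [mul_add]; linarith only [hT1, hT2]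

/-! ## §2 The smeared collar transfer -/

section Main

/-- **Registered stub `stub_symContactOfFemto`: `SymContactKernelSigR ⇐ FBL ∧ SymNearCovLaw`** (line «signed-femto-collar»; the lead's
`contactKernel_of_femto` with the radial weight inside the near observable; Georgii Thm. 4.17). [folklore] -/
theorem stub_symContactOfFemto : SymContactOfFemtoSigR := by
  intro hFBL hNC G _ _ _ _ hG
  letI : MeasurableSpace G := borel G
  haveI : BorelSpace G := ⟨rfl⟩
  intro r a hpos hlim hpin r₁ r₂ hr₁ _hr₁₂ κ hκ
  classical
  haveI : SecondCountableTopology G :=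
    (r.continuous.isClosedEmbedding r.injective).isEmbedding.secondCountableTopology
  obtain ⟨CA, hCA⟩ := r.curvature.bounded
  -- the two femto laws along the pinned unit
  obtain ⟨C₁, β₁, ℓ₁, p, hℓ₁, hC₁, hF⟩ := hFBL G hG r a hpos hlim hpin
  obtain ⟨ℓ₂, hℓ₂, hN⟩ := hNC G hG r a hpos hlim hpin
  -- scales and constants (as in `contactKernel_of_femto`)
  set s : ℝ := min r₁ (min ℓ₁ ℓ₂) / 16 with hs
  have hmin : 0 < min r₁ (min ℓ₁ ℓ₂) := lt_min hr₁ (lt_min hℓ₁ hℓ₂)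
  have hs0 : 0 < s := by rw [hs]; positivity
  have hs_r₁ : 16 * s ≤ r₁ := by
    have := min_le_left r₁ (min ℓ₁ ℓ₂); rw [hs]; linarith only [this]
  have hs_ℓ₁ : 16 * s ≤ ℓ₁ := by
    have := (min_le_right r₁ (min ℓ₁ ℓ₂)).trans (min_le_left _ _); rw [hs]; linarith only [this]
  have hs_ℓ₂ : 16 * s ≤ ℓ₂ := by
    have := (min_le_right r₁ (min ℓ₁ ℓ₂)).trans (min_le_right _ _); rw [hs]; linarith only [this]
  set C₁' : ℝ := C₁ + 1 with hC₁'
  have hC₁'0 : 0 < C₁' := by rw [hC₁']; linarith only [hC₁]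
  have hC₁le : C₁ ≤ C₁' := by rw [hC₁']; linarith only
  set κ' : ℝ := κ * s ^ 8 / (2048 * C₁') with hκ'
  have hκ'0 : 0 < κ' := by rw [hκ']; positivity
  have hd₀ : 0 < s / 4 := by positivity
  have hd₀ℓ : s / 4 ≤ ℓ₂ := by linarith only [hs_ℓ₂, hs0]
  obtain ⟨R, hR, hRd₀, β₂, n, hcov⟩ := hN κ' hκ'0 (s / 4) hd₀ hd₀ℓ
  set Rf : ℝ := min (min R (s / 4)) (min 1 (κ * s ^ 12 / (2 ^ 21 * 81 * C₁' ^ 3))) with hRf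
  have hRf0 : 0 < Rf := by rw [hRf]; positivity
  have hRfR : Rf ≤ R := (min_le_left _ _).trans (min_le_left _ _)
  have hRfs : Rf ≤ s / 4 := (min_le_left _ _).trans (min_le_right _ _)
  have hRf1 : Rf ≤ 1 := (min_le_right _ _).trans (min_le_left _ _)
  have hRfκ : Rf ≤ κ * s ^ 12 / (2 ^ 21 * 81 * C₁' ^ 3) := (min_le_right _ _).trans (min_le_right _ _)
  obtain ⟨β₃, hβ₃⟩ := Filter.eventually_atTop.1 (hlim.eventually (gt_mem_nhds hRf0))
  refine ⟨Rf, hRf0, max β₁ (max β₂ β₃), 4 * s + 8, ?_⟩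
  intro β hβ L hL y _hy z _hz hsep₁ _hsep₂ hball φ hφ1 hφR
  have hβ1 : β₁ ≤ β := le_trans (le_max_left _ _) hβ
  have hβ2 : β₂ ≤ β := le_trans ((le_max_left _ _).trans (le_max_right _ _)) hβ
  have hβ3 : β₃ ≤ β := le_trans ((le_max_right _ _).trans (le_max_right _ _)) hβ
  have ht0 : 0 < a β := hpos β
  have htR : a β < Rf := hβ₃ β hβ3
  have ht1 : a β ≤ 1 := by linarith only [htR, hRf1]
  have hts4 : a β ≤ s / 4 := by linarith only [htR, hRfs]
  -- the cube radius `M = ⌊s / a β⌋`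
  obtain ⟨hM4, hMle, hMge⟩ := floor_facts ht0 hts4
  set M : ℕ := ⌊s / a β⌋₊ with hM
  have hM1 : 1 ≤ M := by omega
  have hM4r : (4 : ℝ) ≤ M := by exact_mod_cast hM4
  have hMpos : (0 : ℝ) < M := by linarith only [hM4r]
  have hMt : (M : ℝ) * a β ≤ s := (le_div_iff₀ ht0).1 hMle
  have hM2t : s ≤ 2 * (M : ℝ) * a β := by
    have := (div_le_iff₀ (by positivity : (0 : ℝ) < 2 * a β)).1 hMge
    linarith only [this]
  -- torus side: injectivity radius
  haveI : NeZero (2 * L + 1) := ⟨by omega⟩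
  have h4M : 4 * M + 8 ≤ L := by
    have h1 : (4 * (M : ℝ) + 8) * a β ≤ (L : ℝ) * a β := by
      have : (4 * (M : ℝ) + 8) * a β ≤ 4 * s + 8 := by linarith only [hMt, ht1, ht0]
      linarith only [this, hL]
    have h2 : (4 * (M : ℝ) + 8) ≤ L := le_of_mul_le_mul_right h1 ht0
    exact_mod_cast h2
  -- femto cubes of side `2M+3`
  have hside : ((2 * M + 3 : ℕ) : ℝ) * a β ≤ 3 * s := by push_cast; linarith only [hMt, hts4, ht0]
  have hb₁ : ((2 * M + 3 : ℕ) : ℝ) * a β ≤ ℓ₁ := by linarith only [hside, hs_ℓ₁, hs0]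
  have hb₂ : ((2 * M + 3 : ℕ) : ℝ) * a β ≤ ℓ₂ := by linarith only [hside, hs_ℓ₂, hs0]
  -- separation of `y` and `z` on the torus
  have hdist : 2 * ((2 : ℝ) * M + 4) ≤ torusDist L y z := by
    have h1 : r₁ ≤ a β * torusDist L y z := hsep₁
    have h2 : 16 * ((M : ℝ) * a β) ≤ a β * torusDist L y z := by linarith only [h1, hMt, hs_r₁]
    have h3 : 16 * (M : ℝ) ≤ torusDist L y z := by
      have h4 : a β * (16 * (M : ℝ)) ≤ a β * torusDist L y z := by linarith only [h2]
      exact le_of_mul_le_mul_left h4 ht0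
    linarith only [h3, hM4r]
  obtain ⟨hsep_yz, hsep_zy⟩ := exists_coord_sep L M y z hdist
  -- the cubes, injectivity and far conditions
  set Qy : Finset (Literature.MathematicalPhysics.QuantumLattice.ZdEdge 4) :=
    cubeEdges (fun k => y k - (M + 1)) (2 * M + 3) with hQy
  set Qz : Finset (Literature.MathematicalPhysics.QuantumLattice.ZdEdge 4) :=
    cubeEdges (fun k => z k - (M + 1)) (2 * M + 3) with hQz
  have hinj_y := injOn_torusProj_cube h4M y
  have hinj_z := injOn_torusProj_cube h4M z
  have hfar_yz : ∀ e ∈ Qz ∪ (plaquettesTouching Qz).biUnion plaquetteEdges, ∀ e' ∈ Qy,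
      torusEdge (2 * L + 1) e ≠ torusEdge (2 * L + 1) e' :=
    fun e he e' he' => torusEdge_ne_cube hsep_yz he he'
  have hfar_zy : ∀ e ∈ Qy ∪ (plaquettesTouching Qy).biUnion plaquetteEdges, ∀ e' ∈ Qz,
      torusEdge (2 * L + 1) e ≠ torusEdge (2 * L + 1) e' :=
    fun e he e' he' => torusEdge_ne_cube hsep_zy he he'
  -- FBL at the centres
  have hFy : ∀ η, |kerE G r β (fun k => y k - (M + 1)) (2 * M + 3) η (dens G r y) - p β| ≤ C₁ / (M : ℝ) ^ 4 :=
    fun η => abs_kerE_dens_centred_sub_le r hC₁ (hF β hβ1) hM1 hb₁ y η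
  have hFz : ∀ η, |kerE G r β (fun k => z k - (M + 1)) (2 * M + 3) η (dens G r z) - p β| ≤ C₁ / (M : ℝ) ^ 4 :=
    fun η => abs_kerE_dens_centred_sub_le r hC₁ (hF β hβ1) hM1 hb₁ z η
  -- torus mean at `z`
  obtain ⟨mz, hmz⟩ : ∃ m : ℝ, m = torusE G r β L (dens G r z) := ⟨_, rfl⟩
  have hmz_p : |mz - p β| ≤ C₁ / (M : ℝ) ^ 4 := by
    rw [hmz]
    exact abs_torusMean_sub_le r β Qz Qz (continuous_dens r z) (fun U => hCA _) (isCylinder_dens_cube r hM1 z) hinj_z hFz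
  have hdz : ∀ η, |kerE G r β (fun k => z k - (M + 1)) (2 * M + 3) η (dens G r z) - mz| ≤ 2 * C₁ / (M : ℝ) ^ 4 := by
    intro η
    have e : kerE G r β (fun k => z k - (M + 1)) (2 * M + 3) η (dens G r z) - mz =
        (kerE G r β (fun k => z k - (M + 1)) (2 * M + 3) η (dens G r z) - p β) - (mz - p β) := by ring
    rw [e]
    calc |(kerE G r β (fun k => z k - (M + 1)) (2 * M + 3) η (dens G r z) - p β) - (mz - p β)|
        ≤ |kerE G r β (fun k => z k - (M + 1)) (2 * M + 3) η (dens G r z) - p β| + |mz - p β| := abs_sub _ _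
      _ ≤ C₁ / (M : ℝ) ^ 4 + C₁ / (M : ℝ) ^ 4 := add_le_add (hFz η) hmz_p
      _ = 2 * C₁ / (M : ℝ) ^ 4 := by ring
  -- tolerance for `dens y`
  set ε₁ : ℝ := C₁' / (M : ℝ) ^ 4 with hε₁
  have hε₁0 : 0 < ε₁ := by rw [hε₁]; positivity
  have hyker : ∀ η, |(∫ U, dens G r y U ∂(ymSpecification r.ρ β Qy η)) - p β| ≤ ε₁ := fun η =>
    (hFy η).trans (div_le_div_of_nonneg_right hC₁le (by positivity))
  -- depth of the centre of `Qz`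
  have hdepth_z : depth (fun k => z k - (M + 1)) (2 * M + 3) z = M + 2 := depth_centred z M
  -- the small ball of lattice vectors `Bw = {w : a‖w‖ < Rf}` and its geometry
  set Bw : Finset (Fin 4 → ℤ) :=
    (Fintype.piFinset fun _ : Fin 4 => Finset.Icc (-(⌊Rf / a β⌋₊ : ℤ)) ⌊Rf / a β⌋₊).filter
      (fun w => a β * ‖siteToE w‖ < Rf) with hBw
  have hBw_lt : ∀ w ∈ Bw, a β * ‖siteToE w‖ < Rf := fun w hw => (Finset.mem_filter.1 hw).2
  have hBw_mem : ∀ w : Fin 4 → ℤ, a β * ‖siteToE w‖ < Rf → w ∈ Bw := fun w hw => mem_ballFinset ht0 w hw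
  have hcardBw : (Bw.card : ℝ) ≤ (2 * (Rf / a β) + 1) ^ 4 := card_ballFinset_le ht0 hRf0.le
  -- geometry of `z + w`, `w ∈ Bw`
  have hwM : ∀ w ∈ Bw, ‖siteToE w‖ ≤ (M : ℝ) / 2 := by
    intro w hw
    have htw := hBw_lt w hw
    have h2 : a β * ‖siteToE w‖ ≤ a β * ((M : ℝ) / 2) := by
      have e : a β * ((M : ℝ) / 2) = 2 * (M : ℝ) * a β / 4 := by ring
      rw [e]; linarith only [htw, hRfs, hM2t]
    exact le_of_mul_le_mul_left h2 ht0
  have h2w : ∀ w ∈ Bw, ∀ j, 2 * |w j| ≤ (M : ℤ) := by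
    intro w hw j
    have h1 : |((w j : ℤ) : ℝ)| ≤ (M : ℝ) / 2 := (abs_apply_le_norm w j).trans (hwM w hw)
    have h2 : ((2 * |w j| : ℤ) : ℝ) ≤ ((M : ℤ) : ℝ) := by push_cast; linarith only [h1]
    exact_mod_cast h2
  have hwj : ∀ w ∈ Bw, ∀ j, |w j| + 1 ≤ (M : ℤ) := fun w hw j => by have := h2w w hw j; omega
  have hwN : ∀ w ∈ Bw, ∀ j, |w j| ≤ ((M / 2 : ℕ) : ℤ) := fun w hw j => by have := h2w w hw j; omega
  -- FBL at `z + w` inside `Qz` and the torus means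
  have hFx' : ∀ w ∈ Bw, ∀ η, |kerE G r β (fun k => z k - (M + 1)) (2 * M + 3) η (dens G r (z + w)) - p β| ≤
      16 * C₁ / (M : ℝ) ^ 4 := by
    intro w hw η
    have hdepth' : M + 2 - M / 2 ≤ depth (fun k => z k - (M + 1)) (2 * M + 3) (z + w) :=
      depth_centred_shift_ge z w M (M / 2) (hwN w hw)
    have hdepth2 : 2 ≤ depth (fun k => z k - (M + 1)) (2 * M + 3) (z + w) := by omega
    have hdepthR : (M : ℝ) / 2 ≤ (depth (fun k => z k - (M + 1)) (2 * M + 3) (z + w) : ℝ) := by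
      have h1 : ((M + 2 - M / 2 : ℕ) : ℝ) ≤ (depth (fun k => z k - (M + 1)) (2 * M + 3) (z + w) : ℝ) := by
        exact_mod_cast hdepth'
      have h2 : M ≤ 2 * (M + 2 - M / 2) := by omega
      have h3 : (M : ℝ) ≤ 2 * ((M + 2 - M / 2 : ℕ) : ℝ) := by exact_mod_cast h2
      linarith only [h1, h3]
    refine (hF β hβ1 (fun k => z k - (M + 1)) (2 * M + 3) hb₁ η (z + w) hdepth2).trans ?_
    have hd0 : (0 : ℝ) < (depth (fun k => z k - (M + 1)) (2 * M + 3) (z + w) : ℝ) := by linarith only [hdepthR, hMpos]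
    rw [div_le_div_iff₀ (by positivity) (by positivity)]
    have h4 : ((M : ℝ) / 2) ^ 4 ≤ (depth (fun k => z k - (M + 1)) (2 * M + 3) (z + w) : ℝ) ^ 4 :=
      pow_le_pow_left₀ (by positivity) hdepthR 4
    have e4 : ((M : ℝ) / 2) ^ 4 = (M : ℝ) ^ 4 / 16 := by ring
    have h5 : (M : ℝ) ^ 4 ≤ 16 * (depth (fun k => z k - (M + 1)) (2 * M + 3) (z + w) : ℝ) ^ 4 := by
      rw [e4] at h4; linarith only [h4]
    have h6 := mul_le_mul_of_nonneg_left h5 hC₁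
    linarith only [h6]
  set m : (Fin 4 → ℤ) → ℝ := fun w => torusE G r β L (dens G r (z + w)) with hmdef
  have hmx_p : ∀ w ∈ Bw, |m w - p β| ≤ 16 * C₁ / (M : ℝ) ^ 4 := by
    intro w hw
    exact abs_torusMean_sub_le r β Qz Qz (continuous_dens r (z + w)) (fun U => hCA _)
      (isCylinder_dens_cube_shift r z w (hwj w hw)) hinj_z (hFx' w hw)
  have hdx : ∀ w ∈ Bw, ∀ η, |kerE G r β (fun k => z k - (M + 1)) (2 * M + 3) η (dens G r (z + w)) - m w| ≤
      32 * C₁ / (M : ℝ) ^ 4 := by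
    intro w hw η
    have e : kerE G r β (fun k => z k - (M + 1)) (2 * M + 3) η (dens G r (z + w)) - m w =
        (kerE G r β (fun k => z k - (M + 1)) (2 * M + 3) η (dens G r (z + w)) - p β) - (m w - p β) := by ring
    rw [e]
    calc |(kerE G r β (fun k => z k - (M + 1)) (2 * M + 3) η (dens G r (z + w)) - p β) - (m w - p β)|
        ≤ |kerE G r β (fun k => z k - (M + 1)) (2 * M + 3) η (dens G r (z + w)) - p β| + |m w - p β| := abs_sub _ _
      _ ≤ 16 * C₁ / (M : ℝ) ^ 4 + 16 * C₁ / (M : ℝ) ^ 4 := add_le_add (hFx' w hw η) (hmx_p w hw)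
      _ = 32 * C₁ / (M : ℝ) ^ 4 := by ring
  -- the smeared near observable `W` and its kernel mean
  set c : (Fin 4 → ℤ) → ℝ := fun w => φ (a β * ‖siteToE w‖) with hcdef
  have hc1 : ∀ w, |c w| ≤ 1 := fun w => hφ1 _
  set W : LGConfig 4 G → ℝ := fun U => ∑ w ∈ Bw, c w * ((dens G r (z + w) U - m w) * (dens G r z U - mz)) with hWdef
  set ε₂ : ℝ := κ' / (M : ℝ) ^ 4 + (Bw.card : ℝ) * (64 * C₁' ^ 2 / (M : ℝ) ^ 8) with hε₂
  have hε₂0 : 0 < ε₂ := by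
    rw [hε₂]
    exact add_pos_of_pos_of_nonneg (by positivity) (mul_nonneg (Nat.cast_nonneg _) (by positivity))
  have hWc : Continuous W := by
    refine continuous_finsetSum _ fun w _ => ?_
    exact continuous_const.mul (((continuous_dens r (z + w)).sub continuous_const).mul
      ((continuous_dens r z).sub continuous_const))
  have hWb : ∀ U, |W U| ≤ ∑ w ∈ Bw, (CA + |m w|) * (CA + |mz|) := by
    intro U
    refine (Finset.abs_sum_le_sum_abs _ _).trans (Finset.sum_le_sum fun w _ => ?_)
    rw [abs_mul, abs_mul]
    have h1 : |dens G r (z + w) U - m w| ≤ CA + |m w| := (abs_sub _ _).trans (add_le_add (hCA _) le_rfl)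
    have h2 : |dens G r z U - mz| ≤ CA + |mz| := (abs_sub _ _).trans (add_le_add (hCA _) le_rfl)
    calc |c w| * (|dens G r (z + w) U - m w| * |dens G r z U - mz|)
        ≤ 1 * ((CA + |m w|) * (CA + |mz|)) :=
          mul_le_mul (hc1 w) (mul_le_mul h1 h2 (abs_nonneg _) ((abs_nonneg _).trans h1)) (by positivity) zero_le_one
      _ = (CA + |m w|) * (CA + |mz|) := one_mul _
  have hcylz : IsCylinder (dens G r z) Qz := isCylinder_dens_cube r hM1 z
  have hWcyl : IsCylinder W Qz := by
    intro U V hUV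
    show (∑ w ∈ Bw, c w * ((dens G r (z + w) U - m w) * (dens G r z U - mz))) =
      ∑ w ∈ Bw, c w * ((dens G r (z + w) V - m w) * (dens G r z V - mz))
    refine Finset.sum_congr rfl fun w hw => ?_
    rw [isCylinder_dens_cube_shift r z w (hwj w hw) hUV, hcylz hUV]
  -- the kernel mean of `W`: smeared near-pair law + FBL twice
  have hWker : ∀ η, |(∫ U, W U ∂(ymSpecification r.ρ β Qz η)) - ∑ w ∈ Bw, c w * n β w| ≤ ε₂ := by
    intro η
    haveI := isProbabilityMeasure_ymSpecification r.ρ r.continuous β Qz η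
    -- linearity of the kernel mean
    have hint : ∀ w ∈ Bw, Integrable (fun U => c w * ((dens G r (z + w) U - m w) * (dens G r z U - mz)))
        (ymSpecification r.ρ β Qz η) := by
      intro w _
      have hmeas : Measurable (fun U => (dens G r (z + w) U - m w) * (dens G r z U - mz)) :=
        (((continuous_dens r (z + w)).sub continuous_const).mul ((continuous_dens r z).sub continuous_const)).measurable
      have hi0 : Integrable (fun U => (dens G r (z + w) U - m w) * (dens G r z U - mz)) (ymSpecification r.ρ β Qz η) := by
        refine integrable_of_abs_le hmeas (C := (CA + |m w|) * (CA + |mz|)) fun U => ?_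
        show |(dens G r (z + w) U - m w) * (dens G r z U - mz)| ≤ (CA + |m w|) * (CA + |mz|)
        rw [abs_mul]
        have h1 : |dens G r (z + w) U - m w| ≤ CA + |m w| := (abs_sub _ _).trans (add_le_add (hCA _) le_rfl)
        have h2 : |dens G r z U - mz| ≤ CA + |mz| := (abs_sub _ _).trans (add_le_add (hCA _) le_rfl)
        exact mul_le_mul h1 h2 (abs_nonneg _) ((abs_nonneg _).trans h1)
      exact hi0.const_mul (c w)
    have e1 : (∫ U, W U ∂(ymSpecification r.ρ β Qz η)) =
        ∑ w ∈ Bw, c w * (kerCov G r β (fun k => z k - (M + 1)) (2 * M + 3) η (dens G r (z + w)) (dens G r z) +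
          (kerE G r β (fun k => z k - (M + 1)) (2 * M + 3) η (dens G r (z + w)) - m w) *
            (kerE G r β (fun k => z k - (M + 1)) (2 * M + 3) η (dens G r z) - mz)) := by
      simp only [hWdef]
      rw [integral_finsetSum _ hint]
      refine Finset.sum_congr rfl fun w _ => ?_
      rw [integral_const_mul]
      congr 1
      exact kerE_centred_mul r β (fun k => z k - (M + 1)) (2 * M + 3) η (continuous_dens r (z + w)) (continuous_dens r z)
        (fun U => hCA _) (fun U => hCA _) (m w) mz
    rw [e1, ← Finset.sum_sub_distrib]
    have e2 : ∀ w ∈ Bw, c w * (kerCov G r β (fun k => z k - (M + 1)) (2 * M + 3) η (dens G r (z + w)) (dens G r z) +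
          (kerE G r β (fun k => z k - (M + 1)) (2 * M + 3) η (dens G r (z + w)) - m w) *
            (kerE G r β (fun k => z k - (M + 1)) (2 * M + 3) η (dens G r z) - mz)) - c w * n β w =
        c w * (kerCov G r β (fun k => z k - (M + 1)) (2 * M + 3) η (dens G r (z + w)) (dens G r z) - n β w) +
          c w * ((kerE G r β (fun k => z k - (M + 1)) (2 * M + 3) η (dens G r (z + w)) - m w) *
            (kerE G r β (fun k => z k - (M + 1)) (2 * M + 3) η (dens G r z) - mz)) := fun w _ => by ring
    rw [Finset.sum_congr rfl e2, Finset.sum_add_distrib]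
    refine (abs_add_le _ _).trans (add_le_add ?_ ?_)
    · -- the smeared near-pair law at depth `M + 2`
      have hdep : R / a β + 2 ≤ (depth (fun k => z k - (M + 1)) (2 * M + 3) z : ℝ) := by
        rw [hdepth_z]; push_cast
        have h1 : R / a β ≤ (M : ℝ) := by
          rw [div_le_iff₀ ht0]; linarith only [hRd₀, hM2t, hs0]
        linarith only [h1]
      have hdep' : s / 4 ≤ a β * (depth (fun k => z k - (M + 1)) (2 * M + 3) z : ℝ) := by
        rw [hdepth_z]; push_cast; nlinarith only [hM2t, ht0]
      -- the law's index set: the full `R`-ball (the weight vanishes off the `Rf`-ball)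
      set Bbig : Finset (Fin 4 → ℤ) :=
        (Fintype.piFinset fun _ : Fin 4 => Finset.Icc (-(⌊R / a β⌋₊ : ℤ)) ⌊R / a β⌋₊).filter
          (fun w => a β * ‖siteToE w‖ < R) with hBbig
      have hBbig_mem : ∀ w : Fin 4 → ℤ, a β * ‖siteToE w‖ < R → w ∈ Bbig := fun w hw => mem_ballFinset ht0 w hw
      have hsub : Bw ⊆ Bbig := fun w hw => hBbig_mem w ((hBw_lt w hw).trans_le hRfR)
      have hφR' : ∀ t, R ≤ t → φ t = 0 := fun t ht => hφR t (hRfR.trans ht)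
      have hlaw := hcov β hβ2 (fun k => z k - (M + 1)) (2 * M + 3) hb₂ η z Bbig hBbig_mem hdep hdep' φ hφ1 hφR'
      have hsumeq : ∑ w ∈ Bbig, φ (a β * ‖siteToE w‖) *
            (kerCov G r β (fun k => z k - (M + 1)) (2 * M + 3) η (dens G r (z + w)) (dens G r z) - n β w) =
          ∑ w ∈ Bw, c w *
            (kerCov G r β (fun k => z k - (M + 1)) (2 * M + 3) η (dens G r (z + w)) (dens G r z) - n β w) := by
        rw [← Finset.sum_subset hsub fun w _ hw => ?_]
        have hge : Rf ≤ a β * ‖siteToE w‖ := le_of_not_gt fun hlt => hw (hBw_mem w hlt)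
        show c w * _ = 0
        rw [show c w = 0 from hφR _ hge, zero_mul]
      rw [hsumeq] at hlaw
      refine hlaw.trans ?_
      rw [hdepth_z]
      refine div_le_div_of_nonneg_left hκ'0.le (by positivity) ?_
      push_cast
      exact pow_le_pow_left₀ hMpos.le (by linarith only) 4
    · refine (Finset.abs_sum_le_sum_abs _ _).trans ?_
      have h3 : ∀ w ∈ Bw, |c w * ((kerE G r β (fun k => z k - (M + 1)) (2 * M + 3) η (dens G r (z + w)) - m w) *
            (kerE G r β (fun k => z k - (M + 1)) (2 * M + 3) η (dens G r z) - mz))| ≤ 64 * C₁' ^ 2 / (M : ℝ) ^ 8 := by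
        intro w hw
        rw [abs_mul, abs_mul]
        have h4 : |kerE G r β (fun k => z k - (M + 1)) (2 * M + 3) η (dens G r (z + w)) - m w| *
            |kerE G r β (fun k => z k - (M + 1)) (2 * M + 3) η (dens G r z) - mz| ≤
            (32 * C₁ / (M : ℝ) ^ 4) * (2 * C₁ / (M : ℝ) ^ 4) :=
          mul_le_mul (hdx w hw η) (hdz η) (abs_nonneg _) (by positivity)
        have h5 : (32 * C₁ / (M : ℝ) ^ 4) * (2 * C₁ / (M : ℝ) ^ 4) ≤ 64 * C₁' ^ 2 / (M : ℝ) ^ 8 := by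
          have hc : C₁ ^ 2 ≤ C₁' ^ 2 := pow_le_pow_left₀ hC₁ hC₁le 2
          have e3 : (32 * C₁ / (M : ℝ) ^ 4) * (2 * C₁ / (M : ℝ) ^ 4) = 64 * C₁ ^ 2 / (M : ℝ) ^ 8 := by
            field_simp; ring
          rw [e3]
          exact div_le_div_of_nonneg_right (by linarith only [hc]) (by positivity)
        calc |c w| * (|kerE G r β (fun k => z k - (M + 1)) (2 * M + 3) η (dens G r (z + w)) - m w| *
              |kerE G r β (fun k => z k - (M + 1)) (2 * M + 3) η (dens G r z) - mz|)
            ≤ 1 * (64 * C₁' ^ 2 / (M : ℝ) ^ 8) := mul_le_mul (hc1 w) (h4.trans h5) (by positivity) zero_le_one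
          _ = 64 * C₁' ^ 2 / (M : ℝ) ^ 8 := one_mul _
      refine (Finset.sum_le_sum h3).trans ?_
      rw [Finset.sum_const, nsmul_eq_mul]
  -- re-indexing the `x`-sum by `w = x − z ∈ Bw` and the two-observable collar bound
  have hreindex : ∑ x ∈ box 4 L, φ (a β * ‖siteToE (x - z)‖) * torusK3 G r β L x y z =
      ∑ w ∈ Bw, c w * torusK3 G r β L (z + w) y z := by
    refine Finset.sum_bij_ne_zero (fun x _ _ => x - z) (fun x _ hne => ?_) (fun x₁ _ _ x₂ _ _ h => ?_)
      (fun w hw hne => ?_) (fun x _ _ => ?_)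
    · refine hBw_mem _ (lt_of_not_ge fun hge => hne ?_)
      rw [hφR _ hge, zero_mul]
    · exact sub_left_injective h
    · refine ⟨z + w, hball w (hBw_lt w hw), ?_, add_sub_cancel_left z w⟩
      rw [add_sub_cancel_left]
      exact hne
    · rw [add_sub_cancel]
  rw [hreindex, sum_torusK3_eq_integral_centred r β L y z Bw c m mz (fun w => rfl) hmz, ← hWdef]
  have hcollar := abs_integral_two_sub_mean_le r β (L' := 2 * L + 1) Qy Qy Qz Qz (continuous_dens r y) hWc
    (fun U => hCA _) hWb (isCylinder_dens_cube r hM1 y) hWcyl hinj_y hinj_z hfar_yz hfar_zy hε₁0 hε₂0 hyker hWker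
  refine hcollar.trans ?_
  -- arithmetic: `4 ε₁ ε₂ ≤ κ a⁸` (`four_mul_eps_mul_eps_le`)
  rw [hε₂, hε₁, hκ']
  exact four_mul_eps_mul_eps_le hκ hs0 ht0 hMpos hC₁'0 hM2t hcardBw (Nat.cast_nonneg _) htR hRf0 hRf1 hRfκ

end Main

end Summit.QuantumFields.YangMills.Cruxes.ResponseLocalisation.Signed

end
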